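import Mathlib
import Summits.Ventures.PercRepro.PuncturedLYMMixT2Q2Table1
import Summits.Ventures.PercRepro.PuncturedLYMMixT2Q2Table2

/-!
# PercRepro — (SP) FOR `2` PAIRWISE DISJOINT TRIPLES AND `2` PAIRWISE DISJOINT QUADRUPLES AT LEVEL `4`: POSITIVITY OF THE DENOMINATORS (1)
(p10, gen 41)

`den > 0`, `Pc > 0` for `n ≥ 14`; `Yc > 0` for `n ≥ 5`.  Nothing here asserts (SP).
-/

namespace PercRepro.PuncturedLYM.Split.TypeLift.MixT2Q2

/-- `den > 0` for `n ≥ 14`. -/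
theorem den_pos (n : ℚ) (hn : 14 ≤ n) : 0 < den n := by
  obtain ⟨n', hn', rfl⟩ : ∃ n', 0 ≤ n' ∧ n = 14 + n' := ⟨n - 14, by linarith, by ring⟩
  have h : den (14 + n') = 373248 * n' ^ 17 + 78257664 * n' ^ 16 + 7715785248 * n' ^ 15 + 475082624304 * n' ^ 14 + 20459028877560 * n' ^ 13 + 653895263579796 * n' ^ 12 + 16060658391369648 * n' ^ 11 + 309622097227917852 * n' ^ 10 + 4742838660429429096 * n' ^ 9 + 58053844106753343996 * n' ^ 8 + 567784910325916413408 * n' ^ 7 + 4411604268998292748212 * n' ^ 6 + 26896318501685506039152 * n' ^ 5 + 125961974580528075622896 * n' ^ 4 + 437582674040167524582528 * n' ^ 3 + 1062485330663282769430656 * n' ^ 2 + 1609851020946814683382272 * n' + 1146002592733616845983744 := by unfold den; ring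
  rw [h]; positivity

/-- `Yc > 0` for `n ≥ 5`. -/
theorem Yc_pos (n : ℚ) (hn : 5 ≤ n) : 0 < Yc n := by
  obtain ⟨n', hn', rfl⟩ : ∃ n', 0 ≤ n' ∧ n = 5 + n' := ⟨n - 5, by linarith, by ring⟩
  have h : Yc (5 + n') = (1 / 120) * n' ^ 5 + (1 / 8) * n' ^ 4 + (17 / 24) * n' ^ 3 + (15 / 8) * n' ^ 2 + (137 / 60) * n' + 1 := by unfold Yc; ring
  rw [h]; positivity

/-- `Pc > 0` for `n ≥ 14`. -/
theorem Pc_pos (n : ℚ) (hn : 14 ≤ n) : 0 < Pc n := by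
  obtain ⟨n', hn', rfl⟩ : ∃ n', 0 ≤ n' ∧ n = 14 + n' := ⟨n - 14, by linarith, by ring⟩
  have h : Pc (14 + n') = (1 / 24) * n' ^ 4 + (25 / 12) * n' ^ 3 + (935 / 24) * n' ^ 2 + (3851 / 12) * n' + 977 := by unfold Pc; ring
  rw [h]; positivity

end PercRepro.PuncturedLYM.Split.TypeLift.MixT2Q2
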